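import Summits.Langlands.Langlands.Theses.BianchiDeligneSerre
import Literature.NumberTheory.Automorphic.AutomorphicRepsGL
import HarnessLib

/-!
# S2aeF of the line `SketchIdeator2` (crux `ParityBlindBianchi.ArtinWeightRealisationEven`, item stmt-Langlands-16619,
# skeleton v6) follows BY NAME from the three items of route BianchiDeligneSerre

Helper file (`--supports stmt-Langlands-16619`, registered sub-goal
`stub_classicalOccurrenceAEF_of_bianchiDeligneSerre`).  The open stub S2aeF `stub_classicalOccurrenceAEF` of
skeleton v6 — every cuspidal `π` of `GL₂(𝔸_K)` of Artin type, `K` imaginary quadratic, carries for every prime `p`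
and `ι : ℚ̄_p ≃ ℂ` a framed `r : Γ_K → GL₂(ℚ̄_p)` WITH FINITE IMAGE, Satake–Frobenius compatible with `π` at all but
finitely many places — is implied verbatim by `BianchiDeligneSerre.PadicAutomorphyArtinTypeK` (item
stmt-Langlands-15868), `…ArithmeticityArtinTypeK` (15869) and the support `…DeligneSerreTransportK` (15870),
exactly as that route's deciding theorem feeds its junction (only the conclusion `r` irreducible is dropped).
Companion of `stub_classicalOccurrenceAE_of_bianchiDeligneSerre` (p163232, the v5 stub without finiteness).
No definition, no named fact; pure logic.
-/

-- the line's namespace `Summit.Langlands.Langlands.…` (summit = problem = `Langlands`) repeats a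
-- component by design
set_option linter.dupNamespace false

namespace Summit.Langlands.Langlands.Theorems.ArtinWeightRealisationEven

open scoped NumberField
open NumberField IsDedekindDomain Filter
open Literature.NumberTheory.Automorphic Literature.NumberTheory.GaloisRepresentations
open Summit.Langlands.Langlands.Theses

/-- **S2aeF ⟸ C1 ∧ C2 ∧ DS (route BianchiDeligneSerre).**  The items `PadicAutomorphyArtinTypeK`
(stmt-Langlands-15868), `ArithmeticityArtinTypeK` (15869) and `DeligneSerreTransportK` (15870) imply the open stub
S2aeF `stub_classicalOccurrenceAEF` of the line `SketchIdeator2` (skeleton v6) verbatim. -/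
theorem stub_classicalOccurrenceAEF_of_bianchiDeligneSerre :
    BianchiDeligneSerre.PadicAutomorphyArtinTypeK → BianchiDeligneSerre.ArithmeticityArtinTypeK → BianchiDeligneSerre.DeligneSerreTransportK → ∀ (K : Type) [Field K] [NumberField K], NumberField.IsTotallyComplex K → Module.finrank ℚ K = 2 → ∀ (hcpt : isCompact_glFiniteIntegralLevel 2 K) (π : CuspidalAutomorphicRepData 2 K hcpt), (∃ T : InfinityType K 2, π.1.HasInfinityType T ∧ ∀ τ : K →+* ℂ, ∀ x ∈ T τ, x.a = 0 ∧ x.b = 0) → ∀ (p : ℕ) [Fact p.Prime] (ι : PadicAlgCl p ≃+* ℂ), ∃ r : FramedGaloisRep K (PadicAlgCl p) 2, Finite r.toMonoidHom.range ∧ ∀ᶠ w : HeightOneSpectrum (𝓞 K) in Filter.cofinite, SatakeFrobCompatibleAt ι π.1 r w := by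
  intro h₁ h₂ h₃ K _ _ hK hK2 hcpt π hπ p _ ι
  obtain ⟨ρ, hfin, -, hρ⟩ := h₃ K hK hK2 hcpt π hπ (h₂ K hK hK2 hcpt π hπ) (h₁ K hK hK2 hcpt π hπ) p ι
  exact ⟨ρ, hfin, hρ⟩

end Summit.Langlands.Langlands.Theorems.ArtinWeightRealisationEven
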